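import Summits.ResolutionOfSingularities.ResolutionOfSingularities.Theorems.ValuativeLuAlphaPTorsorColengthSharp
import Summits.ResolutionOfSingularities.ResolutionOfSingularities.Theorems.ValuativeLuAlphaPTorsorExceptionalLine
import Summits.ResolutionOfSingularities.ResolutionOfSingularities.Theorems.ValuativeLuAlphaPTorsorCornerStep

/-!
# Giraud's corner successor: the colength of the finite part does not increase (Giraud 1983, §2.5)

Helper file for the stub `corner_successor_colength` (F2y) of the line
`pfaff-line-log-final-forms` (crux `Valuative.LuAlphaPTorsor`, item
`stmt-ResolutionOfSingularities-0641`).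

Setting: `(R, 𝔪 = (x, y))` a two-dimensional regular local subring of the field `K`; in the free
step of Giraud's induction `D₀` (of finite colength `c`, `D₀ ≠ R`, order `m ≥ 1`) is the finite
part of the log-content `C_x(f; R)` and `D₁` that of `C_{x,y}(f; R)`, with
`y D₀ ⊆ D₁ ⊆ D₀ = D₁ + (B)`. At the CORNER successor the chart is `A = R[x/y]`
(`chartAdjoin y x`, structure map `ι = chartIncl y x`, `𝔪A = yA`), `T = A_Q` for a prime `Q ∋ y`,
and the new finite part is `H'` with `D₁ T = yʳ H'`. We prove `λ_T(T/H') ≤ λ_R(R/D₀)`: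

* with `H = (D₀T : yᵐ) ⊇ (D₀A : yᵐ)T` one has `λ_T(T/H) + λ_R(R/𝔪ᵐ) ≤ c`
  (`length_quotient_weakTransform_map_add_length_le`);
* case (A') `D₁ ⊆ 𝔪ᵐ⁺¹`: `r = m + 1`, `H' = (D₁T : yᵐ⁺¹) ⊇ H` (as `y D₀ ⊆ D₁`);
* case (B') `D₁ ⊄ 𝔪ᵐ⁺¹`: `r = m`, `H' = (D₁T : yᵐ) ⊆ H ⊆ H' + (B')` with `ι B = yᵐ B'`, and
  `(H' : B') ⊇ (y, ψ)` for the strict transform `ψ` of some `φ ∈ D₁ ∖ 𝔪ᵐ⁺¹`, whence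
  `λ(T/H') ≤ λ(T/(y, ψ)) + λ(T/H) ≤ m + λ(T/H) ≤ λ(R/𝔪ᵐ) + λ(T/H) ≤ c`
  (`exists_strictTransform_chart_length_le`, `length_quotient_pow_maximalIdeal_ge`).

References: J. Giraud, *Forme normale d'une fonction sur une surface de caractéristique
positive*, Bull. SMF 111 (1983), Lemme 2.3 (ii), §2.5; C. Huneke, I. Swanson, *Integral Closure
of Ideals, Rings, and Modules* (2006), Lemma 14.3.4.
-/

set_option linter.dupNamespace false

noncomputable section

open IsLocalRing Literature.AlgebraicGeometry.Resolution

namespace Summit.ResolutionOfSingularities.ResolutionOfSingularities.Theorems.PfaffLine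

section Abstract

variable {T : Type*} [CommRing T]

/-- Colength is antitone: `I ≤ J ⇒ λ(T/J) ≤ λ(T/I)`. [folklore] -/
theorem length_quotient_le_of_le_cornerSuccessor {I J : Ideal T} (h : I ≤ J) :
    Module.length T (T ⧸ J) ≤ Module.length T (T ⧸ I) :=
  Module.length_le_of_surjective (Submodule.factor h) (Submodule.factor_surjective h)

/-- **The cyclic step.** In a commutative ring, if `H' ⊆ H ⊆ H' + (b)` with `b ∈ H` and
`N b ⊆ H'`, then `λ(T/H') ≤ λ(T/N) + λ(T/H)`: the kernel `H/H'` of `T/H' → T/H` is the cyclic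
module generated by the class of `b`, a quotient of `T/N`. [folklore] -/
theorem length_quotient_le_add_of_le_sup_span_cornerSuccessor {H H' N : Ideal T} {b : T}
    (hH'H : H' ≤ H) (hHle : H ≤ H' ⊔ Ideal.span {b}) (hN : ∀ n ∈ N, n * b ∈ H') :
    Module.length T (T ⧸ H') ≤ Module.length T (T ⧸ N) + Module.length T (T ⧸ H) := by
  -- `λ(T/H') = λ(ker (T/H' → T/H)) + λ(T/H)`
  have hexact := Module.length_eq_add_of_exact (LinearMap.ker (Submodule.factor hH'H)).subtype
    (Submodule.factor hH'H) (Submodule.injective_subtype _) (Submodule.factor_surjective hH'H)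
    (LinearMap.exact_subtype_ker_map _)
  -- `g₀ : T → T/H'`, `t ↦ [b t]`, kills `N`, and its range contains the kernel
  let g₀ : T →ₗ[T] T ⧸ H' := (Submodule.mkQ H').comp (LinearMap.mulLeft T b)
  have hg₀ : ∀ t, g₀ t = Submodule.Quotient.mk (b * t) := fun t => rfl
  have hkerg : N ≤ LinearMap.ker g₀ := by
    intro n hn
    rw [LinearMap.mem_ker, hg₀, Submodule.Quotient.mk_eq_zero, mul_comm]
    exact hN n hn
  set g := Submodule.liftQ N g₀ hkerg with hg
  have hrange : LinearMap.ker (Submodule.factor hH'H) ≤ LinearMap.range g := by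
    rw [hg, Submodule.range_liftQ]
    intro z hz
    obtain ⟨t, rfl⟩ := Submodule.mkQ_surjective _ z
    have hz' : (Submodule.Quotient.mk t : T ⧸ H) = 0 := hz
    rw [Submodule.Quotient.mk_eq_zero] at hz'
    obtain ⟨h', hh', c, hc, hsum⟩ := Submodule.mem_sup.mp (hHle hz')
    obtain ⟨d, rfl⟩ := Ideal.mem_span_singleton'.mp hc
    refine ⟨d, ?_⟩
    rw [hg₀, Submodule.mkQ_apply, eq_comm, Submodule.Quotient.eq, ← hsum]
    have e : h' + d * b - b * d = h' := by ring
    rw [e]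
    exact hh'
  calc Module.length T (T ⧸ H')
      = Module.length T (LinearMap.ker (Submodule.factor hH'H)) +
          Module.length T (T ⧸ H) := hexact
    _ ≤ Module.length T (T ⧸ N) + Module.length T (T ⧸ H) := by
        refine add_le_add ?_ le_rfl
        calc Module.length T (LinearMap.ker (Submodule.factor hH'H))
            ≤ Module.length T (LinearMap.range g) :=
              Module.length_le_of_injective (Submodule.inclusion hrange)
                (Submodule.inclusion_injective hrange)
          _ ≤ Module.length T (T ⧸ N) :=
              Module.length_le_of_surjective g.rangeRestrict g.surjective_rangeRestrict

end Abstract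

open IsLocalRing

/-- **Registered stub `corner_successor_colength`** (F2y: Giraud 1983, §2.5 at the corner
successor in the `y`-chart — the colength of the finite part does not increase). For a
two-dimensional regular local ring `(R, 𝔪 = (x, y))` of `K`, ideals `y D₀ ⊆ D₁ ⊆ D₀ = D₁ + (B)`
with `D₀ ≠ R` of finite colength, and a prime `Q ∋ y` of the chart `A = R[x/y]` with `T = A_Q`:
there are `r` and `H'` with `D₁ T = yʳ H'`, `T/H'` of finite length and `λ_T(T/H') ≤ λ_R(R/D₀)`.
With `m = ord D₀` and `H = (D₀T : yᵐ)` (`λ(T/H) + λ(R/𝔪ᵐ) ≤ λ(R/D₀)`,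
`length_quotient_weakTransform_map_add_length_le`): if `D₁ ⊆ 𝔪ᵐ⁺¹` take `r = m + 1`,
`H' = (D₁T : yᵐ⁺¹) ⊇ H`; otherwise `r = m`, `H' = (D₁T : yᵐ)`, `H ⊆ H' + (B')` (`ι B = yᵐ B'`),
`(H' : B') ⊇ (y, ψ)` for the strict transform `ψ` of some `φ ∈ D₁ ∖ 𝔪ᵐ⁺¹`
(`exists_strictTransform_chart_length_le`: `λ(T/(y, ψ)) ≤ m ≤ λ(R/𝔪ᵐ)`), so
`λ(T/H') ≤ λ(T/(y, ψ)) + λ(T/H) ≤ λ(R/D₀)`. [folklore] -/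
theorem corner_successor_colength : ∀ {K : Type} [Field K] {R : Subring K} [IsRegularLocalRing R] {x y : R}, ringKrullDim R = 2 → maximalIdeal R = Ideal.span {x, y} → y ≠ 0 → ∀ (D₁ D₀ : Ideal R) (B : R), D₁ ≤ D₀ → Ideal.span {y} * D₀ ≤ D₁ → D₀ = D₁ ⊔ Ideal.span {B} → IsFiniteLength R (R ⧸ D₀) → D₀ ≠ ⊤ → ∀ (Q : Ideal (Literature.AlgebraicGeometry.Resolution.chartAdjoin (K := K) y x)) [Q.IsPrime], Literature.AlgebraicGeometry.Resolution.chartIncl y x y ∈ Q → ∃ (r : ℕ) (H' : Ideal (LocalSubring.ofPrime (Literature.AlgebraicGeometry.Resolution.chartAdjoin (K := K) y x) Q).toSubring), D₁.map ((algebraMap (Literature.AlgebraicGeometry.Resolution.chartAdjoin (K := K) y x) (LocalSubring.ofPrime (Literature.AlgebraicGeometry.Resolution.chartAdjoin (K := K) y x) Q).toSubring).comp (Literature.AlgebraicGeometry.Resolution.chartIncl y x)) = Ideal.span {((algebraMap (Literature.AlgebraicGeometry.Resolution.chartAdjoin (K := K) y x) (LocalSubring.ofPrime (Literature.AlgebraicGeometry.Resolution.chartAdjoin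 (K := K) y x) Q).toSubring).comp (Literature.AlgebraicGeometry.Resolution.chartIncl y x)) y ^ r} * H' ∧ IsFiniteLength (LocalSubring.ofPrime (Literature.AlgebraicGeometry.Resolution.chartAdjoin (K := K) y x) Q).toSubring ((LocalSubring.ofPrime (Literature.AlgebraicGeometry.Resolution.chartAdjoin (K := K) y x) Q).toSubring ⧸ H') ∧ Module.length (LocalSubring.ofPrime (Literature.AlgebraicGeometry.Resolution.chartAdjoin (K := K) y x) Q).toSubring ((LocalSubring.ofPrime (Literature.AlgebraicGeometry.Resolution.chartAdjoin (K := K) y x) Q).toSubring ⧸ H') ≤ Module.length R (R ⧸ D₀) := by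
  intro K _ R _ x y hdim hm hy0 D₁ D₀ B hD10 hyD0 hD0eq hfin hD0top Q _ hyQ
  -- the order `m` of `D₀`, the sharp bound and `m ≤ λ(R/𝔪ᵐ)`, in the swapped chart `R[x/y]`
  have hm' : maximalIdeal R = Ideal.span {y, x} := by rw [hm, Set.pair_comm]
  obtain ⟨m, hm1, hD0m, hD0m1⟩ :=
    exists_order_cornerStep hD0top (ne_bot_of_isFiniteLength_quotient_cornerStep hdim hfin)
  have hsharp := length_quotient_weakTransform_map_add_length_le (K := K) hdim hm' hy0 hm1 hD0m
    hD0m1 hfin Q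
  have hRm : (m : ℕ∞) ≤ Module.length R (R ⧸ maximalIdeal R ^ m) := by
    obtain ⟨h1, h2⟩ := length_quotient_pow_maximalIdeal_ge hdim
    rcases Nat.lt_or_ge m 2 with hlt | hge
    · obtain rfl : m = 1 := by omega
      simp only [h1, Nat.cast_one, le_refl]
    · have h3 : ((m : ℕ) : ℕ∞) ≤ ((m + 1 : ℕ) : ℕ∞) := by exact_mod_cast Nat.le_succ m
      exact h3.trans (h2 m hge)
  have hBD0 : B ∈ D₀ := by
    rw [hD0eq]; exact Ideal.mem_sup_right (Ideal.mem_span_singleton_self B)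
  have hD1m : D₁ ≤ maximalIdeal R ^ m := hD10.trans hD0m
  -- abbreviations: `T = A_Q`, `ιT : R → T`
  set T : Subring K := (LocalSubring.ofPrime (chartAdjoin (K := K) y x) Q).toSubring with hTdef
  set ιT : R →+* T := (algebraMap (chartAdjoin (K := K) y x) T).comp (chartIncl y x) with hιTdef
  have hmapmap : ∀ J : Ideal R,
      J.map ιT = (J.map (chartIncl y x)).map (algebraMap (chartAdjoin (K := K) y x) T) :=
    fun J => by rw [hιTdef, Ideal.map_map]
  have hιTy : ∀ n : ℕ,
      ιT y ^ n = algebraMap (chartAdjoin (K := K) y x) T (chartIncl y x y ^ n) := fun n => by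
    rw [hιTdef, RingHom.comp_apply, map_pow]
  -- `(D₀A : yᵐ) T ⊆ H := (D₀T : yᵐ)`, so `λ(T/H) + λ(R/𝔪ᵐ) ≤ λ(R/D₀)`
  have hWle : (weakTransformChart y x D₀ m).map (algebraMap (chartAdjoin (K := K) y x) T) ≤
      (D₀.map ιT).colon {ιT y ^ m} := by
    rw [Ideal.map_le_iff_le_comap]
    intro a ha
    have ha' := Submodule.mem_colon_singleton.mp ha
    rw [smul_eq_mul] at ha'
    rw [Ideal.mem_comap, Submodule.mem_colon_singleton, smul_eq_mul, hmapmap, hιTy, ← map_mul]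
    exact Ideal.mem_map_of_mem _ ha'
  have hH : Module.length T (T ⧸ (D₀.map ιT).colon {ιT y ^ m}) +
      Module.length R (R ⧸ maximalIdeal R ^ m) ≤ Module.length R (R ⧸ D₀) :=
    (add_le_add (length_quotient_le_of_le_cornerSuccessor hWle) le_rfl).trans hsharp
  -- the product formula `D₁ T = yʳ (D₁T : yʳ)` for `D₁ ⊆ 𝔪ʳ`
  have hprod : ∀ r : ℕ, D₁ ≤ maximalIdeal R ^ r →
      D₁.map ιT = Ideal.span {ιT y ^ r} * (D₁.map ιT).colon {ιT y ^ r} := fun r hr => by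
    apply eq_span_singleton_mul_colon
    rw [hmapmap, hιTy]
    have h1 := Ideal.map_mono (f := algebraMap (chartAdjoin (K := K) y x) T)
      (map_chartIncl_le_span_pow (K := K) hm' hy0 hr)
    rwa [Ideal.map_span, Set.image_singleton] at h1
  -- finite length from the length bound
  have hfinOf : ∀ H' : Ideal T, Module.length T (T ⧸ H') ≤ Module.length R (R ⧸ D₀) →
      IsFiniteLength T (T ⧸ H') := fun H' h =>
    Module.length_ne_top_iff.mp (ne_top_of_le_ne_top (Module.length_ne_top_iff.mpr hfin) h)
  -- `y · D₀T ⊆ D₁T`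
  have hyD0T : ∀ d ∈ D₀.map ιT, ιT y * d ∈ D₁.map ιT := fun d hd => by
    have h1 : Ideal.span {ιT y} * D₀.map ιT ≤ D₁.map ιT := by
      have := Ideal.map_mono (f := ιT) hyD0
      rwa [Ideal.map_mul, Ideal.map_span, Set.image_singleton] at this
    exact h1 (Ideal.mul_mem_mul (Ideal.mem_span_singleton_self _) hd)
  by_cases hcase : D₁ ≤ maximalIdeal R ^ (m + 1)
  · -- Case (A'): `r = m + 1`, `H' = (D₁T : yᵐ⁺¹) ⊇ H`
    have hle : (D₀.map ιT).colon {ιT y ^ m} ≤ (D₁.map ιT).colon {ιT y ^ (m + 1)} := by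
      intro t ht
      rw [Submodule.mem_colon_singleton, smul_eq_mul] at ht ⊢
      rw [pow_succ, show t * (ιT y ^ m * ιT y) = ιT y * (t * ιT y ^ m) by ring]
      exact hyD0T _ ht
    have hlen : Module.length T (T ⧸ (D₁.map ιT).colon {ιT y ^ (m + 1)}) ≤
        Module.length R (R ⧸ D₀) :=
      (length_quotient_le_of_le_cornerSuccessor hle).trans (le_self_add.trans hH)
    exact ⟨m + 1, (D₁.map ιT).colon {ιT y ^ (m + 1)}, hprod (m + 1) hcase, hfinOf _ hlen, hlen⟩
  · -- Case (B'): `r = m`, `H' = (D₁T : yᵐ) ⊆ H ⊆ H' + (B')`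
    obtain ⟨φ, hφD1, hφm1⟩ := Set.not_subset.mp hcase
    have hφm : φ ∈ maximalIdeal R ^ m := hD1m hφD1
    obtain ⟨ψ, hψ, hψlen⟩ :=
      exists_strictTransform_chart_length_le (K := K) hdim hm' hy0 φ m hφm hφm1
    have hL : Module.length T
        (T ⧸ Ideal.span {ιT y, algebraMap (chartAdjoin (K := K) y x) T ψ}) ≤ (m : ℕ∞) :=
      hψlen Q hyQ
    -- `ι B = yᵐ B'`
    have hBmem : chartIncl (K := K) y x B ∈ Ideal.span {chartIncl (K := K) y x y ^ m} :=
      map_chartIncl_le_span_pow (K := K) hm' hy0 hD0m (Ideal.mem_map_of_mem _ hBD0)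
    obtain ⟨B', hB'⟩ : ∃ B' : T, ιT B = ιT y ^ m * B' := by
      obtain ⟨B'A, hB'A⟩ := Ideal.mem_span_singleton'.mp hBmem
      refine ⟨algebraMap (chartAdjoin (K := K) y x) T B'A, ?_⟩
      rw [hιTy, hιTdef, RingHom.comp_apply, ← hB'A, map_mul, mul_comm]
    set H : Ideal T := (D₀.map ιT).colon {ιT y ^ m} with hHdef
    set H' : Ideal T := (D₁.map ιT).colon {ιT y ^ m} with hH'def
    have hH'H : H' ≤ H := fun t ht => by
      rw [hH'def, Submodule.mem_colon_singleton] at ht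
      rw [hHdef, Submodule.mem_colon_singleton]
      exact Ideal.map_mono hD10 ht
    have hHle : H ≤ H' ⊔ Ideal.span {B'} := by
      intro t ht
      rw [hHdef, Submodule.mem_colon_singleton, smul_eq_mul, hD0eq, Ideal.map_sup, Ideal.map_span,
        Set.image_singleton, hB'] at ht
      obtain ⟨d, hd, c, hc, hdc⟩ := Submodule.mem_sup.mp ht
      obtain ⟨c', rfl⟩ := Ideal.mem_span_singleton'.mp hc
      refine Submodule.mem_sup.mpr
        ⟨t - c' * B', ?_, c' * B', Ideal.mem_span_singleton'.mpr ⟨c', rfl⟩, by ring⟩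
      rw [hH'def, Submodule.mem_colon_singleton, smul_eq_mul]
      have e : (t - c' * B') * ιT y ^ m = d := by linear_combination (-1 : T) * hdc
      rw [e]
      exact hd
    -- `(H' : B') ⊇ (y, ψ)`
    have hN : ∀ n ∈ Ideal.span {ιT y, algebraMap (chartAdjoin (K := K) y x) T ψ},
        n * B' ∈ H' := by
      intro n hn
      obtain ⟨a, b, rfl⟩ := Ideal.mem_span_pair.mp hn
      rw [add_mul, mul_assoc, mul_assoc]
      refine add_mem (Ideal.mul_mem_left _ a ?_)
        (Ideal.mul_mem_left _ b (Ideal.mul_mem_right _ _ ?_))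
      · rw [hH'def, Submodule.mem_colon_singleton, smul_eq_mul]
        have e : ιT y * B' * ιT y ^ m = ιT y * ιT B := by rw [hB']; ring
        rw [e, ← map_mul]
        exact Ideal.mem_map_of_mem _
          (hyD0 (Ideal.mul_mem_mul (Ideal.mem_span_singleton_self y) hBD0))
      · rw [hH'def, Submodule.mem_colon_singleton, smul_eq_mul]
        have e : algebraMap (chartAdjoin (K := K) y x) T ψ * ιT y ^ m = ιT φ := by
          rw [hιTy, hιTdef, RingHom.comp_apply, hψ, map_mul, mul_comm]
        rw [e]
        exact Ideal.mem_map_of_mem _ hφD1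
    have hstep := length_quotient_le_add_of_le_sup_span_cornerSuccessor hH'H hHle hN
    have hlen : Module.length T (T ⧸ H') ≤ Module.length R (R ⧸ D₀) :=
      calc Module.length T (T ⧸ H')
          ≤ Module.length T (T ⧸ Ideal.span {ιT y, algebraMap (chartAdjoin (K := K) y x) T ψ}) +
              Module.length T (T ⧸ H) := hstep
        _ ≤ Module.length R (R ⧸ maximalIdeal R ^ m) + Module.length T (T ⧸ H) :=
            add_le_add (hL.trans hRm) le_rfl
        _ = Module.length T (T ⧸ H) + Module.length R (R ⧸ maximalIdeal R ^ m) := add_comm _ _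
        _ ≤ Module.length R (R ⧸ D₀) := hH
    exact ⟨m, H', hprod m hD1m, hfinOf _ hlen, hlen⟩

end Summit.ResolutionOfSingularities.ResolutionOfSingularities.Theorems.PfaffLine

end
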